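import Literature.NumberTheory.EllipticCurves.CanonicalPeriodSymbolCongruence
import Literature.NumberTheory.EllipticCurves.SharpFlatPAdicLFunctionCoeffField
import Literature.NumberTheory.EllipticCurves.NewformsCoeffFieldHolds
import Literature.FieldTheory.AlgClosed.PadicAlgClEquivComplexCompatible
import Literature.NumberTheory.EllipticCurves.Rank1Residual.Typed.X7
import Literature.NumberTheory.EllipticCurves.LFunctionPrimeCoeff
import Literature.NumberTheory.EllipticCurves.NoConductorOne
import Literature.NumberTheory.GaloisRepresentations.TeichmullerCharacter
import HarnessLib

set_option linter.dupNamespace false -- `…BirchSwinnertonDyer.BirchSwinnertonDyer…` is the cell's nested layout (D-0017)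
set_option autoImplicit false

/-!
# Kan₂ brick K6 — the NON-DEPLETED hypothesis package of Vatsal 1999 for the pair `(W, f ; g, ι)`

Cell `pub/bsd-ssimc` (K3 route `SignedLowerHalves`), crux L = stmt-BirchSwinnertonDyer-23599
`Theses.SignedLowerHalves.SmallImageLowerHalfBothSigns`, line `rtt_w3` (LEAD `cruxlead-stmt-BirchSwinnertonDyer-23599` g0,
skeleton v3), registered stub Kan₂ `stub_thetaLayerLambda_ns : vatsal1999_plusSymbol_congruence → …` (the analytic theta
transport at the layers).  Hand `bsd-line-slh-p3-w3` g11 holds the Kan₂ assembly and its bricks K1/K1′/K2/K3/K5/K7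
(ssimc STATUS 2026-08-29T20:57:35Z); THIS FILE is brick **K6** (LEAD's GO 21:09:24Z to `bsd-inputs-honda-p1` g17):
everything the application of the named fact `ModularForms.vatsal1999_plusSymbol_congruence` (Vatsal 1999 §1 (1.6)/(1.13),
file `Literature/NumberTheory/EllipticCurves/CanonicalPeriodSymbolCongruence.lean`) to the level-matched CM partner datum
`(M, g, ι, Ω)` of the stub needs and that does NOT mention the `S₀`-depleted forms of brick K2:

* §1 **algebraic integers of `ℚ̄_p = PadicAlgCl p` have `Valued.v ≤ 1`** (`Valued.v = ‖·‖₊`, Mathlib `PadicAlgCl.valuation_def`;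
  the `≤ 1 ↔ ‖·‖ ≤ 1` bookkeeping is the tree's `GaloisRepresentations.PadicAlgCl.valuation_le_one_iff`);
* §2 **the field isomorphism `e : ℚ̄_p ≃+* ℂ` EXTENDING the stub's embedding `ι : K_g →+* ℚ̄_p`** (`e (ι x) = x` on
  `K_g = coeffField g`; Steinitz, tree `Literature.FieldTheory.AlgClosed.exists_padicAlgCl_ringEquiv_complex_apply_eq_of_finiteDimensional`,
  with `K_g` a number field by Shimura 1971 Thm. 3.48 = tree THEOREM `IsNewform0.finiteDimensional_coeffField_holds`) — this is the
  `ι : PadicAlgCl p ≃+* ℂ` over which Vatsal's fact is quantified; reading back: `e.symm z = ι ⟨z, _⟩` on `K_g`, in particular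
  `e.symm (aₙ(g)) = embCoeff g ι n`;
* §3 **`p`-integrality of the partner's coefficients along `ι`**: `Valued.v (embCoeff g ι n) ≤ 1` for EVERY embedding `ι`
  (Shimura 3.48(3) = tree THEOREM `IsNewform0.isIntegral_coeff_holds`, transported along `ι`), hence Vatsal's hypothesis
  `∀ n, Valued.v (e.symm (cuspCoeff g n)) ≤ 1`;
* §4 the `W`-side at level `N_W` (`IsNewformOf W f`: `aₙ(f) = aₙ(W) ∈ ℤ`, `K_f = ℚ`): `Valued.v (e.symm (aₙ(f))) ≤ 1`,
  Vatsal's last clause `Valued.v (e.symm (a_ℓ(f) − a_ℓ(W))) < 1` (it is `0`), and `a_ℓ(f) = a_ℓ(E) = frobeniusTrace` at `ℓ ∤ N_W`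
  (tree `LFunction_apply_prime_eq_frobeniusTrace`);
* §5 **the bridge from the stub's congruence currency to Vatsal's**: the stub's
  `‖embCoeff g ι ℓ − (a_ℓ(W) : ℚ̄_p)‖ < 1` at primes `ℓ ∤ p·M·N_W` gives `Valued.v (e.symm (cuspCoeff f ℓ − cuspCoeff g ℓ)) < 1`
  at those primes (the PRIME-LEVEL input of brick K3, which extends it to all `n` on the depleted pair);
* §6 `W[p]` irreducible on the class (`ClassX7`, `p ≠ 2`: good supersingular, Serre 1972 Prop. 12 = tree `ClassX7.irr`), in
  Vatsal's spelling `W.HasIrreducibleModPGaloisRep p`.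

THEOREMS ONLY (no `def`, no named fact, no `sorry`); `--supports stmt-BirchSwinnertonDyer-23599 --as helper`.  Nothing here
proves the stub, the crux, or any case of BSD; Vatsal's theorem itself stays a named fact (hypothesis of the stub).

References: V. Vatsal, *Canonical periods and congruence formulae*, Duke Math. J. 98 (1999), §1 (1.1)–(1.6), Remark (1.12),
Thm. (1.13) [Vatsal1999]; G. Shimura, *Introduction to the arithmetic theory of automorphic functions* (1971), Thm. 3.48
[Shimura1971]; J.-P. Serre, Invent. Math. 15 (1972), §1.11 Prop. 12 [Serre1972]; S. Lang, *Algebra*, GTM 211, Ch. V §2,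
Ch. VIII §1 [Lang2002].
-/

noncomputable section

open scoped MatrixGroups ModularForm NNReal

namespace Summit.BirchSwinnertonDyer.BirchSwinnertonDyer.Theorems.SmallImageRttKanSix

open CongruenceSubgroup WeierstrassCurve Literature.NumberTheory.EllipticCurves
  Literature.NumberTheory.EllipticCurves.ModularForms Literature.NumberTheory.EllipticCurves.Rank1Residual

/-! ## §1 Valuation bookkeeping on `ℚ̄_p` -/

section Valuation

variable {p : ℕ} [Fact p.Prime]

/-- **Algebraic integers of `ℚ̄_p` are `v`-integral**: `IsIntegral ℤ x → Valued.v x ≤ 1` (the valuation ring of `ℚ̄_p` is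
integrally closed and contains `ℤ`). [folklore] -/
theorem valuation_le_one_of_isIntegral {x : PadicAlgCl p} (hx : IsIntegral ℤ x) : Valued.v x ≤ 1 := by
  have hv := Valuation.integer.integers (Valued.v (R := PadicAlgCl p))
  have hx' : IsIntegral (Valued.v (R := PadicAlgCl p)).integer x := hx.tower_top
  exact (hv.isIntegral_iff_v_le_one).mp hx'

end Valuation

/-! ## §2 The isomorphism `e : ℚ̄_p ≃ ℂ` extending `ι : K_g → ℚ̄_p` -/

section Iso

variable {M : ℕ} [NeZero M] (g : CuspForm (Gamma0 M) 2) {p : ℕ} [Fact p.Prime]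
  (ι : coeffField g →+* PadicAlgCl p)

/-- **A field isomorphism `e : ℚ̄_p ≃+* ℂ` with `e ∘ ι = (K_g ⊆ ℂ)`** for a newform `g ∈ S₂(Γ₀(M))` and any embedding
`ι : K_g →+* ℚ̄_p`: `K_g = ℚ(aₙ(g))` is a number field (Shimura 1971 Thm. 3.48, tree theorem
`IsNewform0.finiteDimensional_coeffField_holds`), so Steinitz' extension applies (tree
`exists_padicAlgCl_ringEquiv_complex_apply_eq_of_finiteDimensional`).  This `e` is the `ι : PadicAlgCl p ≃+* ℂ` of
`vatsal1999_plusSymbol_congruence` («fix an isomorphism `ℂ_p ≅ ℂ`» compatible with the given `p`-adic embedding of `K_g`).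
[cite: Shimura1971, Thm. 3.48] [cite: Lang2002, Ch. V §2 and Ch. VIII §1 (Steinitz)] [cite: Vatsal1999, §1 (1.1)] -/
theorem exists_ringEquiv_apply_coe (hg : IsNewform0 g) :
    ∃ e : PadicAlgCl p ≃+* ℂ, ∀ x : coeffField g, e (ι x) = (x : ℂ) := by
  haveI : FiniteDimensional ℚ (coeffField g) := IsNewform0.finiteDimensional_coeffField_holds hg
  exact Literature.FieldTheory.AlgClosed.exists_padicAlgCl_ringEquiv_complex_apply_eq_of_finiteDimensional ι
    (algebraMap (coeffField g) ℂ)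

variable {g ι}

omit [NeZero M] in
/-- Reading back through `e`: for `z ∈ K_g`, `e⁻¹ z = ι z`. [folklore] -/
theorem symm_apply_of_mem {e : PadicAlgCl p ≃+* ℂ} (he : ∀ x : coeffField g, e (ι x) = (x : ℂ)) {z : ℂ}
    (hz : z ∈ coeffField g) : e.symm z = ι ⟨z, hz⟩ := by
  rw [RingEquiv.symm_apply_eq]
  exact (he ⟨z, hz⟩).symm

omit [NeZero M] in
/-- In particular `e⁻¹ (aₙ(g)) = embCoeff g ι n` (`= ι(aₙ(g))`). [folklore] -/
theorem symm_cuspCoeff_eq_embCoeff {e : PadicAlgCl p ≃+* ℂ} (he : ∀ x : coeffField g, e (ι x) = (x : ℂ)) (n : ℕ) :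
    e.symm (cuspCoeff g n) = embCoeff g ι n := by
  rw [embCoeff_def, symm_apply_of_mem he]

omit [NeZero M] in
/-- And `e⁻¹` of a difference `z − w` with `z ∈ K_g`: `e⁻¹ (z − w) = ι z − e⁻¹ w`. [folklore] -/
theorem symm_sub_of_mem {e : PadicAlgCl p ≃+* ℂ} (he : ∀ x : coeffField g, e (ι x) = (x : ℂ)) {z : ℂ}
    (hz : z ∈ coeffField g) (w : ℂ) : e.symm (z - w) = ι ⟨z, hz⟩ - e.symm w := by
  rw [map_sub, symm_apply_of_mem he hz]

/-! ## §3 `p`-integrality of the partner's coefficients along `ι` -/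

variable (g ι)

/-- **`aₙ(g)` is an algebraic integer INSIDE `K_g`** (Shimura 1971 Thm. 3.48(3), tree theorem `IsNewform0.isIntegral_coeff_holds`,
pulled back along the injection `K_g ⊆ ℂ`). [cite: Shimura1971, Thm. 3.48(3)] -/
theorem isIntegral_coeff_coeffField (hg : IsNewform0 g) (n : ℕ) :
    IsIntegral ℤ (⟨cuspCoeff g n, coeff_mem_coeffField g n⟩ : coeffField g) := by
  have h : IsIntegral ℤ (cuspCoeff g n) := IsNewform0.isIntegral_coeff_holds hg n
  exact (isIntegral_algebraMap_iff (algebraMap (coeffField g) ℂ).injective).mp h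

/-- **`ι(aₙ(g))` is an algebraic integer of `ℚ̄_p`** for every embedding `ι : K_g →+* ℚ̄_p`. [cite: Shimura1971, Thm. 3.48(3)] -/
theorem isIntegral_embCoeff (hg : IsNewform0 g) (n : ℕ) : IsIntegral ℤ (embCoeff g ι n) := by
  rw [embCoeff_def]
  exact (isIntegral_coeff_coeffField g hg n).map ι.toIntAlgHom

/-- **Vatsal's integrality hypothesis for `g`, in the stub's currency**: `Valued.v (embCoeff g ι n) ≤ 1` for all `n`, EVERY `ι`
(«the Fourier coefficients lie in `𝒪`»). [cite: Vatsal1999, §1 (1.1) (coefficients in 𝒪)] [cite: Shimura1971, Thm. 3.48(3)] -/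
theorem valuation_embCoeff_le_one (hg : IsNewform0 g) (n : ℕ) : Valued.v (embCoeff g ι n) ≤ 1 :=
  valuation_le_one_of_isIntegral (isIntegral_embCoeff g ι hg n)

/-- The same as a norm bound: `‖embCoeff g ι n‖ ≤ 1`. [cite: Shimura1971, Thm. 3.48(3)] -/
theorem norm_embCoeff_le_one (hg : IsNewform0 g) (n : ℕ) : ‖embCoeff g ι n‖ ≤ 1 :=
  (Literature.NumberTheory.GaloisRepresentations.PadicAlgCl.valuation_le_one_iff _).mp (valuation_embCoeff_le_one g ι hg n)

variable {g ι}

/-- **Vatsal's integrality hypothesis for `g`, in Vatsal's currency**: `∀ n, Valued.v (e⁻¹ (aₙ(g))) ≤ 1` for the extension `e`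
of `ι`. [cite: Vatsal1999, §1 (1.1) (coefficients in 𝒪)] [cite: Shimura1971, Thm. 3.48(3)] -/
theorem valuation_symm_cuspCoeff_le_one (hg : IsNewform0 g) {e : PadicAlgCl p ≃+* ℂ}
    (he : ∀ x : coeffField g, e (ι x) = (x : ℂ)) (n : ℕ) : Valued.v (e.symm (cuspCoeff g n)) ≤ 1 := by
  rw [symm_cuspCoeff_eq_embCoeff he]
  exact valuation_embCoeff_le_one g ι hg n

end Iso

/-! ## §4 The `W`-side at level `N_W` -/

section WSide

variable (W : WeierstrassCurve ℚ) [W.IsElliptic] [W.IsGloballyMinimal] {p : ℕ} [Fact p.Prime]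
  {N : ℕ} [NeZero N] {f : CuspForm (Gamma0 N) 2}

omit [W.IsElliptic] [W.IsGloballyMinimal] in
/-- `aₙ(f) = aₙ(W) ∈ ℤ` is `p`-adically integral through any `e : ℚ̄_p ≃ ℂ` (Vatsal's integrality hypothesis for `f`). [folklore] -/
theorem valuation_symm_cuspCoeff_le_one_of_isNewformOf (hf : IsNewformOf W f) (e : PadicAlgCl p ≃+* ℂ) (n : ℕ) :
    Valued.v (e.symm (cuspCoeff f n)) ≤ 1 := by
  rw [hf.2 n, map_intCast]
  exact valuation_le_one_of_isIntegral isIntegral_algebraMap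

omit [W.IsElliptic] [W.IsGloballyMinimal] in
/-- Vatsal's last clause for `f` — «`a_ℓ(f) ≡ a_ℓ(W)`» — holds with EQUALITY: `Valued.v (e⁻¹ (a_ℓ(f) − a_ℓ(W))) = 0 < 1`
(all `ℓ`; the fact asks it for primes `ℓ ∤ Mp`). [cite: Vatsal1999, §1 Thm. (1.13) (ρ_𝔪 ≅ ρ̄_{E,p})] -/
theorem valuation_symm_cuspCoeff_sub_LFunction_lt_one (hf : IsNewformOf W f) (e : PadicAlgCl p ≃+* ℂ) (ℓ : ℕ) :
    Valued.v (e.symm (cuspCoeff f ℓ - (W.LFunction ℓ : ℂ))) < 1 := by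
  rw [hf.2 ℓ, sub_self, map_zero, Valuation.map_zero]
  exact zero_lt_one

omit [Fact p.Prime] in
/-- At a prime `ℓ ∤ N_W` (good reduction), `a_ℓ(f) = a_ℓ(E) = ℓ + 1 − #Ẽ(𝔽_ℓ)` (`frobeniusTrace`; tree
`LFunction_apply_prime_eq_frobeniusTrace`). [cite: SilvermanAEC2009, §C.16 and Exercise 8.19(a)] -/
theorem cuspCoeff_eq_frobeniusTrace_of_not_dvd_conductorNorm (hf : IsNewformOf W f) {ℓ : ℕ} (hℓ : ℓ.Prime)
    (hℓN : ¬ ℓ ∣ W.conductorNorm ℤ) : cuspCoeff f ℓ = ((W.frobeniusTrace ℓ : ℤ) : ℂ) := by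
  haveI : Fact ℓ.Prime := ⟨hℓ⟩
  rw [hf.2 ℓ, W.LFunction_apply_prime_eq_frobeniusTrace ℓ (W.hasGoodReductionAtPrime_of_not_dvd_conductorNorm' hℓN)]

/-! ## §5 From the stub's congruence currency to Vatsal's, at the primes `ℓ ∤ p·M·N_W` -/

variable {M : ℕ} [NeZero M] {g : CuspForm (Gamma0 M) 2} {ι : coeffField g →+* PadicAlgCl p}

omit [NeZero M] in
/-- **Bridge (one prime).** If `ℓ ∤ N_W` and `‖ι(a_ℓ(g)) − a_ℓ(W)‖ < 1` in `ℚ̄_p` (the stub's congruence at `ℓ`), then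
`Valued.v (e⁻¹ (a_ℓ(f) − a_ℓ(g))) < 1` for the extension `e` of `ι` (Vatsal's «`a_ℓ ≡ b_ℓ (mod π)`» at `ℓ`).
[cite: Vatsal1999, §1 (1.3) display (5), Thm. (1.13)] -/
theorem valuation_symm_cuspCoeff_sub_lt_one_of_norm_embCoeff_sub_lt_one (hf : IsNewformOf W f)
    {e : PadicAlgCl p ≃+* ℂ} (he : ∀ x : coeffField g, e (ι x) = (x : ℂ)) {ℓ : ℕ} (hℓ : ℓ.Prime)
    (hℓN : ¬ ℓ ∣ W.conductorNorm ℤ) (h : ‖embCoeff g ι ℓ - ((W.frobeniusTrace ℓ : ℤ) : PadicAlgCl p)‖ < 1) :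
    Valued.v (e.symm (cuspCoeff f ℓ - cuspCoeff g ℓ)) < 1 := by
  rw [map_sub, symm_cuspCoeff_eq_embCoeff he, cuspCoeff_eq_frobeniusTrace_of_not_dvd_conductorNorm W hf hℓ hℓN,
    map_intCast, ← Valuation.map_neg, neg_sub, PadicAlgCl.valuation_def, ← NNReal.coe_lt_coe, coe_nnnorm, NNReal.coe_one]
  exact h

omit [NeZero M] in
/-- **Bridge (the stub's binder).** From the stub's hypothesis
`∀ ℓ prime, ℓ ∤ p·M·N_W → ‖embCoeff g ι ℓ − a_ℓ(W)‖ < 1` to Vatsal's prime-level congruence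
`∀ ℓ prime, ℓ ∤ p·M·N_W → Valued.v (e⁻¹ (a_ℓ(f) − a_ℓ(g))) < 1` — the input brick K3 extends to ALL `n` on the depleted pair.
[cite: Vatsal1999, §1 (1.3) display (5), Thm. (1.13)] -/
theorem forall_valuation_symm_cuspCoeff_sub_lt_one (hf : IsNewformOf W f) {e : PadicAlgCl p ≃+* ℂ}
    (he : ∀ x : coeffField g, e (ι x) = (x : ℂ))
    (hcong : ∀ ℓ : ℕ, ℓ.Prime → ¬ ℓ ∣ p * M * W.conductorNorm ℤ →
      ‖embCoeff g ι ℓ - (W.frobeniusTrace ℓ : PadicAlgCl p)‖ < 1) :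
    ∀ ℓ : ℕ, ℓ.Prime → ¬ ℓ ∣ p * M * W.conductorNorm ℤ → Valued.v (e.symm (cuspCoeff f ℓ - cuspCoeff g ℓ)) < 1 := by
  intro ℓ hℓ hℓdvd
  have hℓN : ¬ ℓ ∣ W.conductorNorm ℤ := fun h ↦ hℓdvd (dvd_mul_of_dvd_right h _)
  exact valuation_symm_cuspCoeff_sub_lt_one_of_norm_embCoeff_sub_lt_one W hf he hℓ hℓN (by exact_mod_cast hcong ℓ hℓ hℓdvd)

omit [W.IsElliptic] [NeZero N] [NeZero M] in
/-- The stub's congruence at `ℓ ∤ p·M·N_W` read in VALUATION currency on `ℚ̄_p` directly: `Valued.v (ι(a_ℓ(g)) − a_ℓ(W)) < 1`.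
[cite: Vatsal1999, §1 (1.3) display (5)] -/
theorem valuation_embCoeff_sub_frobeniusTrace_lt_one
    (hcong : ∀ ℓ : ℕ, ℓ.Prime → ¬ ℓ ∣ p * M * W.conductorNorm ℤ →
      ‖embCoeff g ι ℓ - (W.frobeniusTrace ℓ : PadicAlgCl p)‖ < 1)
    {ℓ : ℕ} (hℓ : ℓ.Prime) (hℓdvd : ¬ ℓ ∣ p * M * W.conductorNorm ℤ) :
    Valued.v (embCoeff g ι ℓ - (W.frobeniusTrace ℓ : PadicAlgCl p)) < 1 := by
  rw [PadicAlgCl.valuation_def, ← NNReal.coe_lt_coe, coe_nnnorm, NNReal.coe_one]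
  exact hcong ℓ hℓ hℓdvd

/-! ## §6 `W[p]` irreducible on the class -/

omit [NeZero N] in
/-- **`W[p]` is irreducible on the class** (`ClassX7 W p` = good supersingular at `p` and not semistable; `p ≠ 2`): Serre 1972
§1.11 Prop. 12, tree theorem `ClassX7.irr` — in Vatsal's spelling `W.HasIrreducibleModPGaloisRep p` («`ρ_𝔪` is irreducible»,
witnessed by `W`). [cite: Serre1972, §1.11 Prop. 12] [cite: Vatsal1999, Thm. (1.13) (ρ_𝔪 irreducible)] -/
theorem hasIrreducibleModPGaloisRep_of_classX7 (hp : p ≠ 2) (hX : ClassX7 W p) : W.HasIrreducibleModPGaloisRep p :=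
  ClassX7.irr W p hp hX

end WSide

/-! ## §7 The package, assembled under the Kan₂ stub's partner binders -/

section Package

variable (W : WeierstrassCurve ℚ) [W.IsElliptic] [W.IsGloballyMinimal] (p : ℕ) [Fact p.Prime]

/-- **K6 package.** Under the Kan₂ stub's binders for the class pair `(W, p)` and the level-matched partner datum
`(M, g, ι)` (only `IsNewform0 g` and the congruence off `p·M·N_W` are used) and the conductor-level newform `f` of `W`:
there is a field isomorphism `e : ℚ̄_p ≃+* ℂ` extending `ι` such that, in the currency of
`vatsal1999_plusSymbol_congruence` read through `e`, (i) `e⁻¹(aₙ(g)) = ι(aₙ(g))` for all `n`; (ii) `K_f`, `K_g` are number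
fields; (iii) all `aₙ(f)`, `aₙ(g)` are `e`-integral; (iv) `a_ℓ(f) ≡ a_ℓ(g)` at every prime `ℓ ∤ p·M·N_W`; (v) `a_ℓ(f) ≡ a_ℓ(W)`
for all `ℓ`; (vi) `W[p]` is irreducible.  (Hecke-eigenform / normalisation / Condition 1 for the DEPLETED pair and the all-`n`
congruence are bricks K2/K3.) [cite: Vatsal1999, §1 (1.1)–(1.6), Remark (1.12), Thm. (1.13)] [cite: Shimura1971, Thm. 3.48] -/
theorem exists_ringEquiv_vatsalHypotheses (hp : p ≠ 2) (hX : ClassX7 W p)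
    (M : ℕ) [NeZero M] (g : CuspForm (Gamma0 M) 2) (ι : coeffField g →+* PadicAlgCl p) (hg : IsNewform0 g)
    (hcong : ∀ ℓ : ℕ, ℓ.Prime → ¬ ℓ ∣ p * M * W.conductorNorm ℤ →
      ‖embCoeff g ι ℓ - (W.frobeniusTrace ℓ : PadicAlgCl p)‖ < 1)
    [NeZero (W.conductorNorm ℤ)] (f : CuspForm (Gamma0 (W.conductorNorm ℤ)) 2) (hf : IsNewformOf W f) :
    ∃ e : PadicAlgCl p ≃+* ℂ,
      (∀ x : coeffField g, e (ι x) = (x : ℂ)) ∧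
      (∀ n : ℕ, e.symm (cuspCoeff g n) = embCoeff g ι n) ∧
      FiniteDimensional ℚ (coeffField f) ∧ FiniteDimensional ℚ (coeffField g) ∧
      (∀ n : ℕ, Valued.v (e.symm (cuspCoeff f n)) ≤ 1) ∧
      (∀ n : ℕ, Valued.v (e.symm (cuspCoeff g n)) ≤ 1) ∧
      (∀ ℓ : ℕ, ℓ.Prime → ¬ ℓ ∣ p * M * W.conductorNorm ℤ → Valued.v (e.symm (cuspCoeff f ℓ - cuspCoeff g ℓ)) < 1) ∧
      (∀ ℓ : ℕ, Valued.v (e.symm (cuspCoeff f ℓ - (W.LFunction ℓ : ℂ))) < 1) ∧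
      W.HasIrreducibleModPGaloisRep p := by
  obtain ⟨e, he⟩ := exists_ringEquiv_apply_coe g ι hg
  haveI : FiniteDimensional ℚ (coeffField f) := by rw [hf.coeffField_eq_bot]; infer_instance
  exact ⟨e, he, fun n ↦ symm_cuspCoeff_eq_embCoeff he n, ‹_›,
    IsNewform0.finiteDimensional_coeffField_holds hg, fun n ↦ valuation_symm_cuspCoeff_le_one_of_isNewformOf W hf e n,
    fun n ↦ valuation_symm_cuspCoeff_le_one hg he n, forall_valuation_symm_cuspCoeff_sub_lt_one W hf he hcong,
    fun ℓ ↦ valuation_symm_cuspCoeff_sub_LFunction_lt_one W hf e ℓ, hasIrreducibleModPGaloisRep_of_classX7 W hp hX⟩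

end Package

end Summit.BirchSwinnertonDyer.BirchSwinnertonDyer.Theorems.SmallImageRttKanSix

end
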